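import Summits.AtomisticToContinuum.BoseEinsteinCondensation.Theorems.PuffFloor.Negative.PuffFloorFalseForNearMinimisers
import Literature.MathematicalPhysics.QuantumManyBody.LiebYngvasonPoincare
import Literature.MathematicalPhysics.QuantumManyBody.LiebYngvasonLowerBound
import HarnessLib

/-!
# The CAPPED class-blind floor holds at the free gas for near-minimisers (consistency of the repair; crux `HardCoreExtension`, stmt-AtomisticToContinuum-11786)

Standing adversary of crux `HardCoreExtension` (route `BECConjugateDomination`), gen 3, companion of
`QuadraticFloorNearMinFalse.lean`. There the class-blind lever `Ideator3.QuadraticFloor`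
(structure-factor floor `kn m²/(kn m² + Cρ) ≤ S m` for NEAR-minimisers at ALL modes) is refuted at the
free gas by an ultraviolet density modulation; the typed repair caps the floor at `½`. This file proves
that the repair is CONSISTENT where the original fails:

* `structureFactor_ge_half_of_near_const` — if a periodic trial state is `L²(cell)`-close to a
  constant, `∫_{cell^N} ‖Ψ − c‖² ≤ 1/(64N)`, then `S_m(Ψ) ≥ ½` at EVERY mode `m ≠ 0` (uniformly in
  `m`: `‖|ρ̂_m|²‖_∞ ≤ N²` and `∫|ρ̂_m|² = N·L^{3N}`; two Young inequalities, no orthogonality needed);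
* `exists_near_const_of_kinetic_le` — the Neumann Poincaré inequality of the tree
  (`poincare_boxN`, gap `π²/L²`) turns the kinetic bound `T ≤ π²/(64 N L²)` into that closeness;
* `quadraticFloorCapped_holds_at_freeGas` — hence the capped lever, restricted to `v ≡ 0`, HOLDS:
  `C = 0`, any `ρ₀`, every `n`, slack `δ = π²/(64 N L²)` (`E₀^per = 0`, so a `δ`-near-minimiser has
  kinetic energy `≤ δ`), and `min(½, ·) ≤ ½ ≤ S m`.

So at fixed `(N, L)` a dip of FIXED size below `1` at ANY mode costs the kinetic gap, while a dip of
size `O(k⁻²)` costs `O(k⁻²)` (the refutation): the `½`-cap is exactly what separates the two regimes.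
No Theses statement is asserted positively. All `[folklore]`.
-/

noncomputable section

namespace Summit.AtomisticToContinuum.BoseEinsteinCondensation.Theorems.HardCoreExtension.Negative

open Literature.MathematicalPhysics.QuantumManyBody.BoseGas MeasureTheory Filter
open Summit.AtomisticToContinuum.BoseEinsteinCondensation.Theorems.PuffFloor.Negative
open scoped ENNReal NNReal

variable {N : ℕ} {L : ℝ}

/-! ### Elementary inequalities -/

/-- Young: `‖c‖² ≤ (1+s)‖a‖² + (1+s⁻¹)‖a − c‖²` for `s > 0`. [folklore] -/
theorem norm_sq_le_young (a c : ℂ) {s : ℝ} (hs : 0 < s) :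
    ‖c‖ ^ 2 ≤ (1 + s) * ‖a‖ ^ 2 + (1 + s⁻¹) * ‖a - c‖ ^ 2 := by
  have htri : ‖c‖ ≤ ‖a‖ + ‖a - c‖ := by
    have h := norm_add_le a (c - a)
    rw [add_sub_cancel, norm_sub_rev] at h
    exact h
  have hx : 0 ≤ ‖a‖ := norm_nonneg _
  have hy : 0 ≤ ‖a - c‖ := norm_nonneg _
  have hc : 0 ≤ ‖c‖ := norm_nonneg _
  have h1 : ‖c‖ ^ 2 ≤ (‖a‖ + ‖a - c‖) ^ 2 := pow_le_pow_left₀ hc htri 2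
  have h2 : (1 + s) * ‖a‖ ^ 2 + (1 + s⁻¹) * ‖a - c‖ ^ 2 - (‖a‖ + ‖a - c‖) ^ 2 =
      s⁻¹ * (s * ‖a‖ - ‖a - c‖) ^ 2 := by
    field_simp
    ring
  have h3 : 0 ≤ s⁻¹ * (s * ‖a‖ - ‖a - c‖) ^ 2 := by positivity
  linarith

/-- The Bochner normalisation of a periodic trial state: `∫_{cell^N} ‖Ψ‖² = 1`. [folklore] -/
theorem integral_norm_sq_eq_one' (Ψ : PeriodicTrialState N L) :
    ∫ X in cellN N L, ‖Ψ.ψ X‖ ^ 2 = 1 := by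
  have hint : Integrable (fun X => ‖Ψ.ψ X‖ ^ 2) (volume.restrict (cellN N L)) :=
    integrableOn_cellN_real L ((Ψ.contDiff.continuous.norm).pow 2)
  have h := ofReal_integral_eq_lintegral_ofReal hint
    (Filter.Eventually.of_forall fun X => sq_nonneg _)
  simp_rw [← coe_nnnorm_sq_eq_ofReal] at h
  rw [Ψ.norm_eq] at h
  have hnn : 0 ≤ ∫ X in cellN N L, ‖Ψ.ψ X‖ ^ 2 := integral_nonneg fun X => sq_nonneg _
  have := congrArg ENNReal.toReal h
  rwa [ENNReal.toReal_ofReal hnn, ENNReal.toReal_one] at this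

/-- `∫_{cell^N} |ρ̂_m|² = N · L^{3N}` (`m ≠ 0`). [folklore] -/
theorem integral_cellN_normSq_planeWaveSum (hL : 0 < L) {m : Fin 3 → ℤ} (hm : m ≠ 0) :
    ∫ X in cellN N L, ‖∑ j : Fin N, cellWave L m (X j)‖ ^ 2 = (N : ℝ) * (L ^ 3) ^ N := by
  have hfun : (fun X : Config N => ‖∑ j : Fin N, cellWave L m (X j)‖ ^ 2) =
      fun X => pairCorr L m X + N := by
    funext X; rw [pairCorr, planeWaveSum]; ring
  have hi1 : IntegrableOn (fun X : Config N => pairCorr L m X) (cellN N L) volume :=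
    integrableOn_cellN_real L (continuous_pairCorr L m)
  have hi2 : IntegrableOn (fun _ : Config N => (N : ℝ)) (cellN N L) volume :=
    integrableOn_const (by
      rw [volume_cellN]; exact ENNReal.pow_ne_top (ENNReal.pow_ne_top ENNReal.ofReal_ne_top))
  rw [hfun, integral_add hi1 hi2, integral_cellN_pairCorr hL hm, zero_add, setIntegral_const,
    measureReal_cellN hL, smul_eq_mul, mul_comm]

/-! ### Near-constant states have `S_m ≥ ½` at every mode -/

/-- **Core estimate.** If `∫_{cell^N} ‖Ψ − c‖² ≤ 1/(64N)` for some constant `c`, then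
`S_m(Ψ) = N⁻¹∫|ρ̂_m|²|Ψ|² ≥ ½` for every `m ≠ 0`. Proof: pointwise Young twice,
`|Ψ|² ≥ ¾|c|² − 3|Ψ−c|²` and `|Ψ|² ≤ (9/8)|c|² + 9|Ψ−c|²`; integrate against `|ρ̂_m|² ∈ [0, N²]`
(`∫|ρ̂_m|² = N L^{3N}`) and against `1` (`∫|Ψ|² = 1`). [folklore] -/
theorem structureFactor_ge_half_of_near_const (hL : 0 < L) (hN : 0 < N) (Ψ : PeriodicTrialState N L)
    (c : ℂ) (hχ : ∫ X in cellN N L, ‖Ψ.ψ X - c‖ ^ 2 ≤ 1 / (64 * N)) {m : Fin 3 → ℤ} (hm : m ≠ 0) :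
    1 / 2 ≤ (N : ℝ)⁻¹ * ∫ X in cellN N L, ‖∑ j : Fin N, cellWave L m (X j)‖ ^ 2 * ‖Ψ.ψ X‖ ^ 2 := by
  have hN' : (0 : ℝ) < N := by exact_mod_cast hN
  have hV : (0 : ℝ) < (L ^ 3) ^ N := by positivity
  set V : ℝ := (L ^ 3) ^ N with hVdef
  -- notation
  set ρ2 : Config N → ℝ := fun X => ‖∑ j : Fin N, cellWave L m (X j)‖ ^ 2 with hρ2
  set f : Config N → ℝ := fun X => ‖Ψ.ψ X‖ ^ 2 with hf
  set g : Config N → ℝ := fun X => ‖Ψ.ψ X - c‖ ^ 2 with hg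
  have hψc : Continuous Ψ.ψ := Ψ.contDiff.continuous
  have hρ2c : Continuous ρ2 := by
    have h := (contDiff_planeWaveSum (M := N) L m).continuous
    unfold planeWaveSum at h
    exact h.norm.pow 2
  have hfc : Continuous f := (hψc.norm).pow 2
  have hgc : Continuous g := ((hψc.sub continuous_const).norm).pow 2
  have hρ2nn : ∀ X, 0 ≤ ρ2 X := fun X => by positivity
  have hρ2le : ∀ X, ρ2 X ≤ (N : ℝ) ^ 2 := fun X => by
    have h := norm_planeWaveSum_le (M := N) L m X
    unfold planeWaveSum at h
    have h0 : 0 ≤ ‖∑ j : Fin N, cellWave L m (X j)‖ := norm_nonneg _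
    show ‖∑ j : Fin N, cellWave L m (X j)‖ ^ 2 ≤ (N : ℝ) ^ 2
    exact pow_le_pow_left₀ h0 h 2
  -- integrals we know
  have hIρ : ∫ X in cellN N L, ρ2 X = (N : ℝ) * V := integral_cellN_normSq_planeWaveSum hL hm
  have hIf : ∫ X in cellN N L, f X = 1 := integral_norm_sq_eq_one' Ψ
  set κ : ℝ := ∫ X in cellN N L, g X with hκdef
  have hκ0 : 0 ≤ κ := integral_nonneg fun X => by positivity
  set I : ℝ := ∫ X in cellN N L, ρ2 X * f X with hIdef
  -- integrability
  have iρ : IntegrableOn ρ2 (cellN N L) volume := integrableOn_cellN_real L hρ2c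
  have if_ : IntegrableOn f (cellN N L) volume := integrableOn_cellN_real L hfc
  have ig : IntegrableOn g (cellN N L) volume := integrableOn_cellN_real L hgc
  have iρf : IntegrableOn (fun X => ρ2 X * f X) (cellN N L) volume :=
    integrableOn_cellN_real L (hρ2c.mul hfc)
  have iρg : IntegrableOn (fun X => ρ2 X * g X) (cellN N L) volume :=
    integrableOn_cellN_real L (hρ2c.mul hgc)
  have hVol : (volume : Measure (Config N)).real (cellN N L) = V := measureReal_cellN hL N
  -- (1) lower bound on `I`: pointwise `ρ2·f ≥ ¾‖c‖² ρ2 − 3 N² g`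
  have hpt1 : ∀ X, 3 / 4 * ‖c‖ ^ 2 * ρ2 X - 3 * (N : ℝ) ^ 2 * g X ≤ ρ2 X * f X := by
    intro X
    have hy := norm_sq_le_young (Ψ.ψ X) c (by norm_num : (0 : ℝ) < 1 / 3)
    have hf' : 3 / 4 * ‖c‖ ^ 2 - 3 * g X ≤ f X := by
      simp only [hf, hg]
      norm_num at hy
      linarith
    have h1 : (3 / 4 * ‖c‖ ^ 2 - 3 * g X) * ρ2 X ≤ f X * ρ2 X :=
      mul_le_mul_of_nonneg_right hf' (hρ2nn X)
    have h2 : g X * ρ2 X ≤ g X * (N : ℝ) ^ 2 :=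
      mul_le_mul_of_nonneg_left (hρ2le X) (by positivity)
    nlinarith
  have hI : 3 / 4 * ‖c‖ ^ 2 * ((N : ℝ) * V) - 3 * (N : ℝ) ^ 2 * κ ≤ I := by
    have hlin : ∫ X in cellN N L, (3 / 4 * ‖c‖ ^ 2 * ρ2 X - 3 * (N : ℝ) ^ 2 * g X) =
        3 / 4 * ‖c‖ ^ 2 * ((N : ℝ) * V) - 3 * (N : ℝ) ^ 2 * κ := by
      rw [integral_sub (iρ.const_mul _) (ig.const_mul _), integral_const_mul, integral_const_mul,
        hIρ]
    rw [← hlin]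
    exact setIntegral_mono ((iρ.const_mul _).sub (ig.const_mul _)) iρf hpt1
  -- (2) upper bound on `1 = ∫ f`: pointwise `f ≤ (9/8)‖c‖² + 9 g`
  have hpt2 : ∀ X, f X ≤ 9 / 8 * ‖c‖ ^ 2 + 9 * g X := by
    intro X
    have hy := norm_sq_le_young c (Ψ.ψ X) (by norm_num : (0 : ℝ) < 1 / 8)
    rw [norm_sub_rev] at hy
    simp only [hf, hg]
    norm_num at hy
    linarith
  have h1 : 1 ≤ 9 / 8 * ‖c‖ ^ 2 * V + 9 * κ := by
    have hlin : ∫ X in cellN N L, (9 / 8 * ‖c‖ ^ 2 + 9 * g X) = 9 / 8 * ‖c‖ ^ 2 * V + 9 * κ := by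
      have ic : IntegrableOn (fun _ : Config N => 9 / 8 * ‖c‖ ^ 2) (cellN N L) volume :=
        integrableOn_const (by
          rw [volume_cellN]; exact ENNReal.pow_ne_top (ENNReal.pow_ne_top ENNReal.ofReal_ne_top))
      rw [integral_add ic (ig.const_mul _), setIntegral_const, integral_const_mul, hVol, smul_eq_mul]
      ring
    rw [← hIf, ← hlin]
    refine setIntegral_mono if_ ?_ hpt2
    exact (integrableOn_const (by
      rw [volume_cellN]; exact ENNReal.pow_ne_top (ENNReal.pow_ne_top ENNReal.ofReal_ne_top))).add
      (ig.const_mul _)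
  -- (3) algebra: `κ ≤ 1/(64N)` ⇒ `I ≥ N(2/3 − 9/64) ≥ N/2`
  have hκ : κ ≤ 1 / (64 * N) := hχ
  have hκN : (N : ℝ) * κ ≤ 1 / 64 := by
    have := mul_le_mul_of_nonneg_left hκ hN'.le
    rwa [mul_one_div, mul_comm (64 : ℝ), ← div_div, div_self hN'.ne'] at this
  have hu : 8 / 9 * (1 - 9 * κ) ≤ ‖c‖ ^ 2 * V := by nlinarith
  have hI2 : 2 / 3 * (N : ℝ) * (1 - 9 * κ) - 3 * (N : ℝ) ^ 2 * κ ≤ I := by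
    have := mul_le_mul_of_nonneg_left hu (by positivity : (0 : ℝ) ≤ 3 / 4 * N)
    nlinarith
  have hN1 : (1 : ℝ) ≤ N := by exact_mod_cast hN
  have hI3 : (N : ℝ) / 2 ≤ I := by nlinarith
  rw [inv_mul_eq_div, le_div_iff₀ hN']
  linarith

/-! ### From the kinetic bound to closeness: the Poincaré inequality of the cube -/

/-- **Poincaré step.** If the kinetic energy on the cell is `≤ π²/(64 N L²)` then Ψ is
`L²(cell)`-close to its mean: `∫_{cell^N} ‖Ψ − c‖² ≤ 1/(64N)` with `c = ⨍_{box} Ψ`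
(tree: `poincare_boxN`, Neumann gap `π²/L²`; `boxN =ᵐ cellN`). [folklore] -/
theorem exists_near_const_of_kinetic_le (hL : 0 < L) (hN : 0 < N) (Ψ : PeriodicTrialState N L)
    (hT : ∫⁻ X in cellN N L, kineticDensity Ψ.ψ X ≤
      ENNReal.ofReal (Real.pi ^ 2 / L ^ 2 * (1 / (64 * N)))) :
    ∃ c : ℂ, ∫ X in cellN N L, ‖Ψ.ψ X - c‖ ^ 2 ≤ 1 / (64 * N) := by
  have hN' : (0 : ℝ) < N := by exact_mod_cast hN
  set c : ℂ := ⨍ Y in boxN N L, Ψ.ψ Y with hc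
  refine ⟨c, ?_⟩
  have hP := Poincare.poincare_boxN N L hL Ψ.ψ Ψ.contDiff
  rw [setLIntegral_congr (boxN_ae_eq_cellN N L), setLIntegral_congr (boxN_ae_eq_cellN N L)] at hP
  have hgap : 0 < Real.pi ^ 2 / L ^ 2 := by positivity
  have hA : ∫⁻ X in cellN N L, ((‖Ψ.ψ X - c‖₊ : ℝ≥0∞)) ^ 2 ≤ ENNReal.ofReal (1 / (64 * N)) := by
    have h := hP.trans hT
    rw [ENNReal.ofReal_mul hgap.le] at h
    exact (ENNReal.mul_le_mul_iff_right (ENNReal.ofReal_pos.2 hgap).ne' ENNReal.ofReal_ne_top).1 h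
  have hint : Integrable (fun X => ‖Ψ.ψ X - c‖ ^ 2) (volume.restrict (cellN N L)) :=
    integrableOn_cellN_real L (((Ψ.contDiff.continuous.sub continuous_const).norm).pow 2)
  have h := ofReal_integral_eq_lintegral_ofReal hint
    (Filter.Eventually.of_forall fun X => sq_nonneg _)
  simp_rw [← coe_nnnorm_sq_eq_ofReal] at h
  rw [← h] at hA
  exact (ENNReal.ofReal_le_ofReal_iff (by positivity)).1 hA

/-- For the free gas a `δ`-near-minimiser has kinetic energy `≤ δ` (`E₀^per = 0`, no interaction).
[folklore] -/
theorem kinetic_le_of_nearMinimiser_free (hL : 0 < L) (Ψ : PeriodicTrialState N L) {δ : ℝ≥0∞}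
    (hE : periodicEnergy (0 : ℝ → ℝ≥0∞) Ψ ≤ periodicGroundStateEnergy (0 : ℝ → ℝ≥0∞) N L + δ) :
    ∫⁻ X in cellN N L, kineticDensity Ψ.ψ X ≤ δ := by
  rw [periodicGroundStateEnergy_zero_eq_zero N hL, zero_add, periodicEnergy] at hE
  refine le_trans (le_of_eq (lintegral_congr fun X => ?_)) hE
  rw [periodicInteraction_zeroPotential, zero_mul, add_zero]

/-! ### The capped lever holds at the free gas -/

/-- **Consistency of the repair at `v ≡ 0`.** The capped class-blind floor
`min(½, kn m²/(kn m² + Cρ)) ≤ S m` for near-minimisers (the body of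
`Cruxes/HardCoreExtension/Disproof.lean :: Levers.QuadraticFloorCapped`, instantiated at the free gas)
HOLDS: `C = 0`, `ρ₀ = 1`, every `n`, `δ = π²/L² · 1/(64N)`. Contrast:
`QuadraticFloorNearMinFalse.quadraticFloorNearMin_false` (the uncapped floor fails here at every slack).
[folklore] -/
theorem quadraticFloorCapped_holds_at_freeGas :
    ∃ C : ℝ, 0 ≤ C ∧ ∃ ρ₀ : ℝ, 0 < ρ₀ ∧ ∀ ρ : ℝ, 0 < ρ → ρ < ρ₀ →
      ∀ᶠ n : ℕ in atTop, ∃ δ : ℝ≥0∞, 0 < δ ∧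
        ∀ Ψ : PeriodicTrialState (n + 1) (sideLength ρ (n + 1)),
          (let L : ℝ := sideLength ρ (n + 1)
           let S : (Fin 3 → ℤ) → ℝ := fun m => ((n : ℝ) + 1)⁻¹ *
             ∫ X in cellN (n + 1) L, ‖∑ j : Fin (n + 1), cellWave L m (X j)‖ ^ 2 * ‖Ψ.ψ X‖ ^ 2
           let kn : (Fin 3 → ℤ) → ℝ := fun m => ‖((2 * Real.pi / L) • latticeVec 1 m)‖
           periodicEnergy (0 : ℝ → ℝ≥0∞) Ψ ≤
               periodicGroundStateEnergy (0 : ℝ → ℝ≥0∞) (n + 1) L + δ →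
           periodicEnergy (0 : ℝ → ℝ≥0∞) Ψ ≠ ⊤ →
           (∀ X, Ψ.ψ X = (‖Ψ.ψ X‖ : ℂ)) →
           ∀ m : Fin 3 → ℤ, m ≠ 0 → min (1 / 2) (kn m ^ 2 / (kn m ^ 2 + C * ρ)) ≤ S m) := by
  refine ⟨0, le_rfl, 1, one_pos, fun ρ hρ _ => Filter.Eventually.of_forall fun n => ?_⟩
  have hL : 0 < sideLength ρ (n + 1) := Real.rpow_pos_of_pos (by positivity) _
  set L : ℝ := sideLength ρ (n + 1) with hLdef
  have hNpos : 0 < n + 1 := Nat.succ_pos n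
  have hNr : (0 : ℝ) < ((n + 1 : ℕ) : ℝ) := by exact_mod_cast hNpos
  refine ⟨ENNReal.ofReal (Real.pi ^ 2 / L ^ 2 * (1 / (64 * ((n + 1 : ℕ) : ℝ)))),
    ENNReal.ofReal_pos.2 (by positivity), fun Ψ => ?_⟩
  dsimp only
  intro hE _ _ m hm
  refine (min_le_left _ _).trans ?_
  have hT := kinetic_le_of_nearMinimiser_free hL Ψ hE
  obtain ⟨c, hc⟩ := exists_near_const_of_kinetic_le hL hNpos Ψ hT
  have h := structureFactor_ge_half_of_near_const hL hNpos Ψ c hc hm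
  push_cast at h
  exact h

end Summit.AtomisticToContinuum.BoseEinsteinCondensation.Theorems.HardCoreExtension.Negative

end
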